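import Summits.CriticalPhenomena.PercolationContinuityZ3.Theorems.PercNearOneGluingNoHeavyLowerTailCILGlueBridge
import HarnessLib

/-!
# `NoHeavyLowerTail` (stmt-CriticalPhenomena-4575) — the glue bridge for a whole BLOCK: gluing a vertex set to a root by weight-one
# pairs = closing the reachability relation through the block

Support file (prover `prim-hp-3`, hull-port line; `--supports stmt-CriticalPhenomena-4575`).  No definitions, no named facts, no sorries.
Bookkeeping lemma (ii-b) of the Lean roadmap for the overtaking bound (run/shared/lean/prim/prim-hp-3/PROOF-OVERTAKING-BOUND.md §5),
iterating the one-pair bridge `Hyperedge.real_update_one_reachFunctional` (`…CILGlueBridge`).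

Notation: for a relation `R` on `Fin n` and a finite vertex set `B`, the CLOSED relation is `R^B(a,b) :⟺ R(a,b) ∨ (a ~_R B ∧ B ~_R b)`
(`a ~_R B` = `∃ t ∈ B, R a t`, `B ~_R b` = `∃ t ∈ B, R t b`); it is written out in full below (no definitions).

* `Hyperedge.reachClosure_pair_iff` — closure composition: for a reflexive and transitive `R` and `r ∈ B`, `(R^B)^{{r,s}} = R^{insert s B}` pointwise.
* `Hyperedge.reachClosure_singleton_iff` — `R^{{r}} = R` for a transitive `R`.
* `Hyperedge.real_glueList_reachFunctional` — **block bridge**: for every weight `w`, root `r`, list `L` of vertices `≠ r` and functional `Φ`,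
  `μ_{W}{Φ(Reach)} = μ_w{Φ(Reach^{insert r L.toFinset})}` where `W = L.foldr (fun s w' => w'[s(r,s) ↦ 1]) w` glues every vertex of `L` to `r`.
-/

noncomputable section

namespace Summit.CriticalPhenomena.PercolationContinuityZ3.Theorems

open MeasureTheory Set Literature.Probability.LatticeModels Literature.Probability.Percolation
open scoped Classical BigOperators

variable {n : ℕ}

namespace Hyperedge

/-- Closure through a singleton is trivial for a transitive relation: `R^{{r}}(a,b) ↔ R(a,b)`. [folklore] -/
theorem reachClosure_singleton_iff (R : Fin n → Fin n → Prop) (htrans : ∀ a b c, R a b → R b c → R a c) (r a b : Fin n) :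
    (R a b ∨ ((∃ t ∈ ({r} : Finset (Fin n)), R a t) ∧ ∃ t ∈ ({r} : Finset (Fin n)), R t b)) ↔ R a b := by
  constructor
  · rintro (h | ⟨⟨t, ht, hat⟩, ⟨t', ht', htb⟩⟩)
    · exact h
    · rw [Finset.mem_singleton] at ht ht'
      subst ht; subst ht'
      exact htrans _ _ _ hat htb
  · exact fun h => Or.inl h

/-- **Closure composition.**  For a reflexive, transitive relation `R`, a set `B ∋ r` and a vertex `s`: closing `R^B` through the pair `{r,s}`
is closing `R` through `insert s B`. [folklore] -/
theorem reachClosure_pair_iff (R : Fin n → Fin n → Prop) (hrefl : ∀ a, R a a) (htrans : ∀ a b c, R a b → R b c → R a c)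
    (B : Finset (Fin n)) {r : Fin n} (hr : r ∈ B) (s a b : Fin n) :
    ((R a b ∨ ((∃ t ∈ B, R a t) ∧ ∃ t ∈ B, R t b)) ∨
        ((∃ t ∈ ({r, s} : Finset (Fin n)), (R a t ∨ ((∃ t' ∈ B, R a t') ∧ ∃ t' ∈ B, R t' t))) ∧
          ∃ t ∈ ({r, s} : Finset (Fin n)), (R t b ∨ ((∃ t' ∈ B, R t t') ∧ ∃ t' ∈ B, R t' b)))) ↔
      (R a b ∨ ((∃ t ∈ insert s B, R a t) ∧ ∃ t ∈ insert s B, R t b)) := by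
  have hrs_sub : ∀ t ∈ ({r, s} : Finset (Fin n)), t ∈ insert s B := by
    intro t ht
    simp only [Finset.mem_insert, Finset.mem_singleton] at ht
    rcases ht with rfl | rfl
    · exact Finset.mem_insert_of_mem hr
    · exact Finset.mem_insert_self _ _
  have hB_sub : ∀ t ∈ B, t ∈ insert s B := fun t ht => Finset.mem_insert_of_mem ht
  constructor
  · rintro ((h | ⟨⟨t, ht, hat⟩, ⟨t', ht', htb⟩⟩) | ⟨⟨t₁, ht₁, h₁⟩, ⟨t₂, ht₂, h₂⟩⟩)
    · exact Or.inl h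
    · exact Or.inr ⟨⟨t, hB_sub t ht, hat⟩, ⟨t', hB_sub t' ht', htb⟩⟩
    · right
      refine ⟨?_, ?_⟩
      · rcases h₁ with h | ⟨⟨t, ht, hat⟩, _⟩
        · exact ⟨t₁, hrs_sub t₁ ht₁, h⟩
        · exact ⟨t, hB_sub t ht, hat⟩
      · rcases h₂ with h | ⟨_, ⟨t, ht, htb⟩⟩
        · exact ⟨t₂, hrs_sub t₂ ht₂, h⟩
        · exact ⟨t, hB_sub t ht, htb⟩
  · rintro (h | ⟨⟨t₁, ht₁, h₁⟩, ⟨t₂, ht₂, h₂⟩⟩)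
    · exact Or.inl (Or.inl h)
    · rw [Finset.mem_insert] at ht₁ ht₂
      have hrmem : r ∈ ({r, s} : Finset (Fin n)) := Finset.mem_insert_self _ _
      have hsmem : s ∈ ({r, s} : Finset (Fin n)) := Finset.mem_insert_of_mem (Finset.mem_singleton_self _)
      rcases ht₁ with rfl | ht₁B
      · rcases ht₂ with heq | ht₂B
        · -- through `s` twice: plain transitivity
          subst heq
          exact Or.inl (Or.inl (htrans _ _ _ h₁ h₂))
        · -- `a ~ s`, `B ~ b`: via `s` and `r`
          right
          exact ⟨⟨t₁, hsmem, Or.inl h₁⟩, ⟨r, hrmem, Or.inr ⟨⟨r, hr, hrefl r⟩, ⟨t₂, ht₂B, h₂⟩⟩⟩⟩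
      · rcases ht₂ with heq | ht₂B
        · subst heq
          right
          exact ⟨⟨r, hrmem, Or.inr ⟨⟨t₁, ht₁B, h₁⟩, ⟨r, hr, hrefl r⟩⟩⟩, ⟨t₂, hsmem, Or.inl h₂⟩⟩
        · exact Or.inl (Or.inr ⟨⟨t₁, ht₁B, h₁⟩, ⟨t₂, ht₂B, h₂⟩⟩)

/-- **Block bridge.**  Gluing every vertex of a list `L` (no member equal to the root `r`) to `r` by weight-one pairs turns the probability of any
reachability functional into the `w`-probability of the functional of the relation closed through the block `insert r L.toFinset`. [folklore] -/
theorem real_glueList_reachFunctional (w : Sym2 (Fin n) → unitInterval) (r : Fin n) :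
    ∀ (L : List (Fin n)), (∀ s ∈ L, s ≠ r) → ∀ (Φ : (Fin n → Fin n → Prop) → Prop),
      (prodBernoulli (L.foldr (fun s w' => Function.update w' s(r, s) 1) w)).real
          {ω : BondConfig (Fin n) | Φ fun a b => (openGraph ω).Reachable a b} =
        (prodBernoulli w).real {ω : BondConfig (Fin n) |
          Φ fun a b => (openGraph ω).Reachable a b ∨
            ((∃ t ∈ insert r L.toFinset, (openGraph ω).Reachable a t) ∧
              ∃ t ∈ insert r L.toFinset, (openGraph ω).Reachable t b)}
  | [], _, Φ => by
    simp only [List.foldr_nil, List.toFinset_nil, Finset.insert_empty]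
    congr 1
    ext ω
    simp only [mem_setOf_eq]
    have hrel : (fun a b => (openGraph ω).Reachable a b ∨
        ((∃ t ∈ ({r} : Finset (Fin n)), (openGraph ω).Reachable a t) ∧
          ∃ t ∈ ({r} : Finset (Fin n)), (openGraph ω).Reachable t b)) = fun a b => (openGraph ω).Reachable a b := by
      funext a b
      exact propext (reachClosure_singleton_iff _ (fun a b c hab hbc => hab.trans hbc) r a b)
    rw [hrel]
  | s :: L, hL, Φ => by
    have hsr : s ≠ r := hL s (by simp)
    have hL' : ∀ t ∈ L, t ≠ r := fun t ht => hL t (List.mem_cons_of_mem s ht)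
    rw [List.foldr_cons, real_update_one_reachFunctional _ hsr.symm]
    -- induction hypothesis for the composed functional `Φ ∘ (·)^{rs}`
    have ih := real_glueList_reachFunctional w r L hL' (fun R => Φ fun a b => R a b ∨
      ((∃ t ∈ ({r, s} : Finset (Fin n)), R a t) ∧ ∃ t ∈ ({r, s} : Finset (Fin n)), R t b))
    beta_reduce at ih
    rw [ih]
    congr 1
    ext ω
    simp only [mem_setOf_eq, List.toFinset_cons]
    have hrel : (fun a b => ((openGraph ω).Reachable a b ∨
          ((∃ t ∈ insert r L.toFinset, (openGraph ω).Reachable a t) ∧ ∃ t ∈ insert r L.toFinset, (openGraph ω).Reachable t b)) ∨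
        ((∃ t ∈ ({r, s} : Finset (Fin n)), ((openGraph ω).Reachable a t ∨
            ((∃ t' ∈ insert r L.toFinset, (openGraph ω).Reachable a t') ∧ ∃ t' ∈ insert r L.toFinset, (openGraph ω).Reachable t' t))) ∧
          ∃ t ∈ ({r, s} : Finset (Fin n)), ((openGraph ω).Reachable t b ∨
            ((∃ t' ∈ insert r L.toFinset, (openGraph ω).Reachable t t') ∧ ∃ t' ∈ insert r L.toFinset, (openGraph ω).Reachable t' b)))) =
        fun a b => (openGraph ω).Reachable a b ∨
          ((∃ t ∈ insert r (insert s L.toFinset), (openGraph ω).Reachable a t) ∧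
            ∃ t ∈ insert r (insert s L.toFinset), (openGraph ω).Reachable t b) := by
      funext a b
      rw [Finset.insert_comm r s L.toFinset]
      exact propext (reachClosure_pair_iff _ (fun a => SimpleGraph.Reachable.refl a) (fun a b c hab hbc => hab.trans hbc)
        (insert r L.toFinset) (Finset.mem_insert_self r _) s a b)
    rw [hrel]

end Hyperedge

end Summit.CriticalPhenomena.PercolationContinuityZ3.Theorems
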